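import Literature.Analysis.FluidPDE.SwirlMaximumPrinciple
import HarnessLib

/-!
# SHEET LAWS (ROUND-21 of nsreg-p2), engine step (3): the weak parabolic maximum principle with the
# sub-solution implication only at POSITIVE local maxima, and second-order calculus at a maximum

Prover seat nsreg-p4 (gen 14), line material of the route `SwirlThreshold`
(`--supports stmt-NavierStokesRegularity-2002`); theorems only.  Tools for the comparison proof of
S-21.1 `SheetLaws.OddContrastMaxPrinciple`:

* `weak_max_principle_pos` — the tree's abstract weak maximum principle
  `Literature.Analysis.FluidPDE.weak_max_principle` (Lieberman 1996, Ch. II, Lemma 2.1/2.3; proof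
  pattern of `SwirlMaximumPrinciple.lean`) with the sub-solution implication required only at points
  where `w` has a POSITIVE LOCAL MAXIMUM in space: `0 < w t x → IsLocalMax (w t) x → wₜ t x ≤ 0`.
  The tree's proof already isolates the positivity and the local-maximum property of the extremal
  point; this form is what a zeroth-order (potential) term with the good sign only on `{w > 0}` needs,
  and it hands the full local-maximum information (not only `∇w = 0`, `Δw ≤ 0`) to the user — here the
  second derivative ALONG THE VERTICAL LINE at sheet points.
* `IsLocalMax.fderiv_fderiv_apply_nonpos` — at a local maximum of a `C²` function every pure second
  directional derivative is `≤ 0` (the tree's `IsLocalMax.deriv_deriv_nonpos` along the line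
  `σ ↦ x + σ e`, as in `IsLocalMax.laplacian_nonpos`).
* Line/gradient/Laplacian algebra of `y ↦ a g(y) − h(y)` and the pure second derivatives of the
  barrier `M + c (1 + |y|²)` (`fderiv_fderiv_barrier_apply`: `2c |e|²`).

WHAT THIS IS NOT: abstract calculus; nothing here is a statement about Navier–Stokes.
-/

noncomputable section

open MeasureTheory Set Function Filter Topology Metric InnerProductSpace WithLp
open scoped RealInnerProductSpace Laplacian ContDiff NNReal

namespace Summit.NavierStokesRegularity.NavierStokesRegularity.Theorems.SheetLaws

/-! ## The weak maximum principle, positive-part form -/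

section WeakMax

variable {E : Type*} [NormedAddCommGroup E]

/-- **Weak parabolic maximum principle, sub-solution implication at positive local maxima only**
(Lieberman 1996, Ch. II, Lemma 2.1 with Lemma 2.3, abstract form; variant of the tree's
`Literature.Analysis.FluidPDE.weak_max_principle`).  Let `K` be compact, `U ⊆ K` open, and let
`w : ℝ → E → ℝ` be jointly continuous on `[T₁, T₂] × K` with a left time derivative `wₜ t x` (within
`[T₁, t]`) at the points of `(T₁, T₂] × U`.  Assume that at every `(t, x) ∈ (T₁, T₂] × U` where
`w t x > 0` and `w t` has a local maximum at `x` one has `wₜ t x ≤ 0`, and that `w ≤ 0` on the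
parabolic boundary (`t = T₁` on `K`; `[T₁, T₂] × (K ∖ U)`).  Then `w ≤ 0` on `[T₁, T₂] × K`.
Proof: verbatim the tree's — a positive value forces a positive maximum of `w − θ(t − T₁)` off the
parabolic boundary, where `w > 0`, `w t` has a local maximum, and the left derivative gives
`wₜ ≥ θ > 0`. -/
theorem weak_max_principle_pos {K U : Set E} (hK : IsCompact K) (hU : IsOpen U) (hUK : U ⊆ K)
    {T₁ T₂ : ℝ} {w wₜ : ℝ → E → ℝ}
    (hc : ContinuousOn (uncurry w) (Icc T₁ T₂ ×ˢ K))
    (ht : ∀ t ∈ Ioc T₁ T₂, ∀ x ∈ U, HasDerivWithinAt (fun s => w s x) (wₜ t x) (Icc T₁ t) t)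
    (hsub : ∀ t ∈ Ioc T₁ T₂, ∀ x ∈ U, 0 < w t x → IsLocalMax (w t) x → wₜ t x ≤ 0)
    (hbot : ∀ x ∈ K, w T₁ x ≤ 0)
    (hlat : ∀ t ∈ Icc T₁ T₂, ∀ x ∈ K \ U, w t x ≤ 0) :
    ∀ t ∈ Icc T₁ T₂, ∀ x ∈ K, w t x ≤ 0 := by
  by_contra H
  push Not at H
  obtain ⟨t₀, ht₀, x₀, hx₀, hpos⟩ := H
  -- the perturbation `θ (t - T₁)`
  set δ : ℝ := w t₀ x₀ with hδ
  set θ : ℝ := δ / (2 * (T₂ - T₁ + 1)) with hθ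
  have hT : T₁ ≤ T₂ := ht₀.1.trans ht₀.2
  have hθpos : 0 < θ := div_pos hpos (by linarith)
  have hθδ : θ * (t₀ - T₁) < δ := by
    have h1 : θ * (t₀ - T₁) ≤ θ * (T₂ - T₁ + 1) :=
      mul_le_mul_of_nonneg_left (by linarith [ht₀.2]) hθpos.le
    have h2 : θ * (T₂ - T₁ + 1) = δ / 2 := by
      rw [hθ, div_mul_eq_mul_div, mul_div_mul_right _ _ (by linarith : (T₂ - T₁ + 1) ≠ 0)]
    linarith
  -- a maximum point of `g = w - θ (t - T₁)` on the compact `[T₁, T₂] × K`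
  set S : Set (ℝ × E) := Icc T₁ T₂ ×ˢ K with hS
  have hSc : IsCompact S := isCompact_Icc.prod hK
  set g : ℝ × E → ℝ := fun p => w p.1 p.2 - θ * (p.1 - T₁) with hg
  have hgc : ContinuousOn g S := by
    have h3 : Continuous fun p : ℝ × E => θ * (p.1 - T₁) := by fun_prop
    exact hc.sub h3.continuousOn
  obtain ⟨⟨t', x'⟩, ⟨ht', hx'⟩, hmax⟩ := hSc.exists_isMaxOn ⟨(t₀, x₀), ht₀, hx₀⟩ hgc
  simp only at ht' hx'
  have hmax' : ∀ t ∈ Icc T₁ T₂, ∀ x ∈ K, w t x - θ * (t - T₁) ≤ w t' x' - θ * (t' - T₁) :=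
    fun t ht x hx => hmax (show (t, x) ∈ S from ⟨ht, hx⟩)
  have hgpos : 0 < w t' x' - θ * (t' - T₁) := by
    have := hmax' t₀ ht₀ x₀ hx₀
    linarith
  have hwpos : 0 < w t' x' := by
    have : 0 ≤ θ * (t' - T₁) := mul_nonneg hθpos.le (by linarith [ht'.1])
    linarith
  -- the maximum point is off the parabolic boundary
  have ht'1 : T₁ < t' := by
    rcases eq_or_lt_of_le ht'.1 with h | h
    · exfalso
      have hb := hbot x' hx'
      rw [h] at hb
      linarith
    · exact h
  have hx'U : x' ∈ U := by
    by_contra hxU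
    have hl := hlat t' ht' x' ⟨hx', hxU⟩
    linarith
  have ht'I : t' ∈ Ioc T₁ T₂ := ⟨ht'1, ht'.2⟩
  -- local maximum in space
  have hloc : IsLocalMax (w t') x' := by
    filter_upwards [hU.mem_nhds hx'U] with x hx
    have := hmax' t' ht' x (hUK hx)
    linarith
  have hwt : wₜ t' x' ≤ 0 := hsub t' ht'I x' hx'U hwpos hloc
  -- the left time derivative of `g (·, x')` at `t'` is nonnegative
  have hderiv : HasDerivWithinAt (fun s => w s x' - θ * (s - T₁)) (wₜ t' x' - θ) (Icc T₁ t') t' := by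
    have h1 := ht t' ht'I x' hx'U
    have h2 : HasDerivWithinAt (fun s : ℝ => θ * (s - T₁)) θ (Icc T₁ t') t' := by
      have := ((hasDerivAt_id t').sub_const T₁).const_mul θ
      simpa using this.hasDerivWithinAt
    exact h1.sub h2
  have hmaxOn : IsLocalMaxOn (fun s => w s x' - θ * (s - T₁)) (Icc T₁ t') t' :=
    Filter.eventually_of_mem self_mem_nhdsWithin fun s hs =>
      hmax' s ⟨hs.1, hs.2.trans ht'.2⟩ x' hx'
  have hcone : T₁ - t' ∈ posTangentConeAt (Icc T₁ t') t' := by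
    have hseg : segment ℝ t' T₁ ⊆ Icc T₁ t' := by
      rw [segment_symm, segment_eq_Icc ht'1.le]
    exact sub_mem_posTangentConeAt_of_segment_subset hseg
  have key : (T₁ - t') * (wₜ t' x' - θ) ≤ 0 := by
    simpa using hmaxOn.hasFDerivWithinAt_nonpos hderiv.hasFDerivWithinAt hcone
  -- `(T₁ - t') (wₜ - θ) ≤ 0` with `T₁ - t' < 0` forces `wₜ ≥ θ > 0`
  have hneg : T₁ - t' < 0 := by linarith
  have : 0 ≤ wₜ t' x' - θ := by
    by_contra hcon
    push Not at hcon
    have := mul_pos_of_neg_of_neg hneg hcon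
    linarith
  linarith

end WeakMax

/-! ## Second-order conditions along a line at a local maximum -/

section SecondOrder

variable {E : Type*} [NormedAddCommGroup E] [InnerProductSpace ℝ E]

/-- **At a local maximum of a `C²` function every pure second directional derivative is
nonpositive**: `D(D W · e)(x) e ≤ 0` (the line `σ ↦ W(x + σ e)` has a local maximum at `0`; the
tree's `IsLocalMax.deriv_deriv_nonpos`, computed as in `IsLocalMax.laplacian_nonpos`). -/
theorem IsLocalMax.fderiv_fderiv_apply_nonpos {W : E → ℝ} {x : E} (hW : ContDiff ℝ 2 W)
    (h : IsLocalMax W x) (e : E) :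
    fderiv ℝ (fun y => fderiv ℝ W y e) x e ≤ 0 := by
  set φ : ℝ → ℝ := fun σ => W (x + σ • e) with hφ
  have hWd : Differentiable ℝ W := hW.differentiable (by norm_num)
  -- first derivative along the line
  have hφ1 : deriv φ = fun σ => fderiv ℝ W (x + σ • e) e :=
    funext fun σ => (Literature.Analysis.FluidPDE.hasDerivAt_comp_line hWd x e σ).deriv
  -- second derivative along the line at `0`
  have hD1 : ContDiff ℝ 1 fun z => fderiv ℝ W z e :=
    (hW.fderiv_right (m := 1) le_rfl).clm_apply contDiff_const
  have hφ2 : deriv (deriv φ) 0 = fderiv ℝ (fun y => fderiv ℝ W y e) x e := by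
    rw [hφ1]
    have h2 := Literature.Analysis.FluidPDE.hasDerivAt_comp_line (hD1.differentiable (by norm_num)) x e 0
    rw [zero_smul, add_zero] at h2
    exact h2.deriv
  -- `φ` has a local maximum at `0`
  have hmax : IsLocalMax φ 0 := by
    have hx : IsLocalMax W ((fun σ : ℝ => x + σ • e) 0) := by
      rw [show (fun σ : ℝ => x + σ • e) 0 = x by simp]
      exact h
    have hl : ContinuousAt (fun σ : ℝ => x + σ • e) 0 := by fun_prop
    exact IsLocalMax.comp_continuous (g := fun σ : ℝ => x + σ • e) hx hl
  have hcφ : ContinuousAt φ 0 := (hWd.continuous.comp (by fun_prop)).continuousAt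
  rw [← hφ2]
  exact Literature.Analysis.FluidPDE.IsLocalMax.deriv_deriv_nonpos hmax hcφ

end SecondOrder

/-! ## Algebra of `y ↦ a g(y) − h(y)` : gradient, Laplacian, pure second derivatives -/

section Algebra

variable {E : Type*} [NormedAddCommGroup E] [InnerProductSpace ℝ E] [FiniteDimensional ℝ E]

omit [FiniteDimensional ℝ E] in
/-- Gradient of `a g − h`. -/
theorem fderiv_const_mul_sub {g h : E → ℝ} {x : E} (hg : DifferentiableAt ℝ g x)
    (hh : DifferentiableAt ℝ h x) (a : ℝ) :
    fderiv ℝ (fun y => a * g y - h y) x = a • fderiv ℝ g x - fderiv ℝ h x := by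
  rw [fderiv_fun_sub (hg.const_mul a) hh, fderiv_const_mul hg]

/-- Laplacian of `a g − h` for `C²` functions. -/
theorem laplacian_const_mul_sub {g h : E → ℝ} {x : E} (hg : ContDiff ℝ 2 g) (hh : ContDiff ℝ 2 h)
    (a : ℝ) : (Δ (fun y => a * g y - h y)) x = a * (Δ g) x - (Δ h) x := by
  have h1 : ContDiffAt ℝ 2 (fun y => a * g y) x := (contDiff_const.mul hg).contDiffAt
  have hfun : (fun y => a * g y - h y) = (fun y => a * g y) - h := by
    funext y; simp
  have h3 : (Δ (fun y => a * g y)) x = a * (Δ g) x := by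
    have : (fun y => a * g y) = a • g := by funext y; simp [smul_eq_mul]
    rw [this, laplacian_smul a hg.contDiffAt, smul_eq_mul]
  rw [hfun, h1.laplacian_sub hh.contDiffAt, h3]

omit [FiniteDimensional ℝ E] in
/-- Pure second directional derivative of `a g − h` for `C²` functions. -/
theorem fderiv_fderiv_const_mul_sub_apply {g h : E → ℝ} (hg : ContDiff ℝ 2 g) (hh : ContDiff ℝ 2 h)
    (a : ℝ) (x e : E) :
    fderiv ℝ (fun y => fderiv ℝ (fun y => a * g y - h y) y e) x e =
      a * fderiv ℝ (fun y => fderiv ℝ g y e) x e - fderiv ℝ (fun y => fderiv ℝ h y e) x e := by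
  have hgd : Differentiable ℝ g := hg.differentiable (by norm_num)
  have hhd : Differentiable ℝ h := hh.differentiable (by norm_num)
  have hfun : (fun y => fderiv ℝ (fun y => a * g y - h y) y e) =
      fun y => a * fderiv ℝ g y e - fderiv ℝ h y e := by
    funext y
    rw [fderiv_const_mul_sub (hgd y) (hhd y) a]
    simp [smul_eq_mul]
  rw [hfun]
  have hg1 : DifferentiableAt ℝ (fun y => fderiv ℝ g y e) x :=
    (((hg.fderiv_right (m := 1) le_rfl).clm_apply contDiff_const).differentiable one_ne_zero) x
  have hh1 : DifferentiableAt ℝ (fun y => fderiv ℝ h y e) x :=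
    (((hh.fderiv_right (m := 1) le_rfl).clm_apply contDiff_const).differentiable one_ne_zero) x
  rw [fderiv_const_mul_sub hg1 hh1 a]
  simp [smul_eq_mul]

end Algebra

/-! ## The barrier `M + c (1 + |y|²)`: pure second derivatives -/

section Barrier

open Literature.Analysis.FluidPDE

/-- First directional derivative of the barrier: `D(M + c(1 + |·|²))(y) e = 2c ⟪y, e⟫`. -/
theorem fderiv_barrier_apply (M c : ℝ) (y e : EuclideanSpace ℝ (Fin 3)) :
    fderiv ℝ (fun y : EuclideanSpace ℝ (Fin 3) => M + c * (1 + ‖y‖ ^ 2)) y e = c * (2 * ⟪y, e⟫) := by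
  rw [(hasFDerivAt_barrier M c y).fderiv]
  simp [innerSL_apply_apply, nsmul_eq_mul]

/-- **Pure second directional derivatives of the barrier**: `D(D(M + c(1+|·|²)) · e)(x) e = 2c |e|²`. -/
theorem fderiv_fderiv_barrier_apply (M c : ℝ) (x e : EuclideanSpace ℝ (Fin 3)) :
    fderiv ℝ (fun y => fderiv ℝ (fun y : EuclideanSpace ℝ (Fin 3) => M + c * (1 + ‖y‖ ^ 2)) y e) x e =
      2 * c * ‖e‖ ^ 2 := by
  have hfun : (fun y => fderiv ℝ (fun y : EuclideanSpace ℝ (Fin 3) => M + c * (1 + ‖y‖ ^ 2)) y e) =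
      fun y => (2 * c) * ⟪e, y⟫ := by
    funext y
    rw [fderiv_barrier_apply, real_inner_comm]
    ring
  rw [hfun]
  have h1 : HasFDerivAt (fun y : EuclideanSpace ℝ (Fin 3) => ⟪e, y⟫) (innerSL ℝ e) x :=
    (innerSL ℝ e).hasFDerivAt
  rw [fderiv_const_mul h1.differentiableAt, h1.fderiv]
  rw [show ((2 * c) • (innerSL ℝ) e) e = (2 * c) * ((innerSL ℝ) e) e from rfl,
    innerSL_apply_apply, real_inner_self_eq_norm_sq]

/-- The barrier's pure second derivative along the vertical unit vector is `2c`. -/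
theorem fderiv_fderiv_barrier_single_two (M c : ℝ) (x : EuclideanSpace ℝ (Fin 3)) :
    fderiv ℝ (fun y => fderiv ℝ (fun y : EuclideanSpace ℝ (Fin 3) => M + c * (1 + ‖y‖ ^ 2)) y
      (EuclideanSpace.single 2 1)) x (EuclideanSpace.single 2 1) = 2 * c := by
  rw [fderiv_fderiv_barrier_apply]
  simp

end Barrier

end Summit.NavierStokesRegularity.NavierStokesRegularity.Theorems.SheetLaws

end
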